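import Literature.AlgebraicGeometry.Motives.SubschemeCyclesDimProofs
import Literature.AlgebraicGeometry.Resolution.AlterationsDimension
import Literature.RingTheory.KrullDimension.AffineCatenary
import Literature.Topology.KrullDimensionDrop
import Mathlib.AlgebraicGeometry.Fiber
import Mathlib.RingTheory.Ideal.Height
import HarnessLib

/-!
# The dimension inequality `dim 𝒪_{Y,y} + dim 𝒪_{X_y,x} ≤ dim 𝒪_{X,x}` for a morphism of varieties

Topic: `Literature/AlgebraicGeometry/Dimension`. For a morphism `f : X → Y` of schemes locally
of finite type over a field `k`, with `X` integral, `x ∈ X`, `y = f x`, and the fibre `X_y` all of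
whose irreducible components have dimension `≤ r`, where `dim X = dim Y + r`:

`dim 𝒪_{Y,y} + dim 𝒪_{X_y,x̄} ≤ dim 𝒪_{X,x}`   (`ringKrullDim_stalk_add_ringKrullDim_stalk_fiber_le`),

the converse of Matsumura's inequality `dim B ≤ dim A + dim B/𝔪_A B` (Thm. 15.1 (i), Mathlib
`Ideal.height_le_height_add_of_liesOver`); together they give de Jong's hypothesis
"`dim B = d + r`" of 2.8 in the situation of 4.12 (a fibration in curves over `ℙ^{d-1}`).
The proof is the transcendence-degree count of Görtz–Wedhorn I, Thm. 5.22 / Hartshorne II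
Ex. 3.20, 3.22: writing `h(p)` for the dimension of the closure of a point `p` and `c(p) = dim 𝒪_p`
for its codimension,
* `c(x) + h(x) = dim X` for `X` integral (affine domains are catenary, Matsumura Thm. 5.6:
  `coheight_add_height_eq_topologicalKrullDim`),
* `c(y) + h(y) ≤ dim Y` and `c(x̄) + h(x̄) ≤ dim X_y ≤ r` (chains through a point,
  `height_add_coheight_le_topologicalKrullDim`; the dimension of a space is attained on an
  irreducible component, `topologicalKrullDim_le_of_forall_mem_irreducibleComponents`),
* `h(x) = trdeg_k κ(x) = trdeg_k κ(y) + trdeg_{κ(y)} κ(x) = h(y) + h(x̄)`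
  (`Literature.AlgebraicGeometry.Motives.Scheme.height_eq_toENat_trdeg_of_isPreimmersion` and
  the tower law).

## References

* U. Görtz, T. Wedhorn, *Algebraic Geometry I*, 2nd ed. (2020), Thm. 5.22, Lemma 14.109.
  [GortzWedhorn2020]
* R. Hartshorne, *Algebraic Geometry* (1977), II Ex. 3.20, Ex. 3.22. [Hartshorne1977]
* H. Matsumura, *Commutative Ring Theory* (1986), Thm. 5.6, Thm. 15.1. [Matsumura1987]
-/

noncomputable section

universe u

open CategoryTheory CategoryTheory.Limits AlgebraicGeometry TopologicalSpace Topology Order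
  IsLocalRing

namespace Literature.AlgebraicGeometry.Dimension

/-! ### Dimension of a space from its irreducible components; chains through a point -/

/-- **The dimension of a scheme is bounded by those of its irreducible components**: a chain of
specialisations `x₀ ⤳ x₁ ⤳ ⋯ ⤳ xₙ` of points lies in the (closed) irreducible component of its
generic end `x₀`, so it is a chain of that component. [folklore] -/
theorem topologicalKrullDim_le_of_forall_mem_irreducibleComponents (X : Scheme.{u}) (n : ℕ)
    (h : ∀ C ∈ irreducibleComponents (X : Type u), topologicalKrullDim C ≤ n) :
    topologicalKrullDim X ≤ n := by
  rw [show topologicalKrullDim X = krullDim X from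
    krullDim_eq_of_orderIso (irreducibleSetEquivPoints (α := X))]
  refine iSup_le fun s => ?_
  -- the irreducible component of the generic end of the chain contains the chain
  let C : Set X := irreducibleComponent s.last
  have hC : C ∈ irreducibleComponents (X : Type u) :=
    irreducibleComponent_mem_irreducibleComponents s.last
  have hCcl : IsClosed C := isClosed_irreducibleComponent
  have hmem : ∀ i, s i ∈ C := fun i =>
    (Scheme.le_iff_specializes.mp (s.strictMono.monotone (Fin.le_last i))).mem_closed hCcl
      mem_irreducibleComponent
  -- as a chain of the subspace `C` (in the order induced from `X`, which is its own
  -- specialisation order)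
  let s' : LTSeries C := LTSeries.mk s.length (fun i => ⟨s i, hmem i⟩) fun i j hij =>
    s.strictMono hij
  haveI : QuasiSober C := Literature.Topology.quasiSober_of_isClosed hCcl
  have hiso : krullDim C = @krullDim C (specializationOrder C).toPreorder :=
    @krullDim_eq_of_orderIso C C _ (specializationOrder C).toPreorder
      { toEquiv := Equiv.refl C
        map_rel_iff' := fun {a b} => by
          change (b ⤳ a) ↔ ((b : X) ⤳ (a : X))
          exact (IsInducing.subtypeVal.specializes_iff).symm }
  calc (s.length : WithBot ℕ∞) = s'.length := rfl
    _ ≤ krullDim C := s'.length_le_krullDim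
    _ = topologicalKrullDim C := by
      rw [hiso]; exact (Literature.Topology.topologicalKrullDim_eq_krullDim (X := C)).symm
    _ ≤ n := h C hC

/-- `height x + coheight x ≤ dim X` for a point `x` of a scheme `X` (chains below and above `x`
concatenate; Mathlib `Order.krullDim_eq_iSup_height_add_coheight_of_nonempty`). [folklore] -/
theorem height_add_coheight_le_topologicalKrullDim {X : Scheme.{u}} (x : X) :
    ((height x + coheight x : ℕ∞) : WithBot ℕ∞) ≤ topologicalKrullDim X := by
  haveI : Nonempty X := ⟨x⟩
  rw [show topologicalKrullDim X = krullDim X from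
    krullDim_eq_of_orderIso (irreducibleSetEquivPoints (α := X)),
    krullDim_eq_iSup_height_add_coheight_of_nonempty, WithBot.coe_le_coe]
  exact le_iSup (fun a : X => height a + coheight a) x

/-- **`dim 𝒪_{X,x} + dim closure {x} = dim X` for `X` integral, locally of finite type over a
field** (Görtz–Wedhorn I, Thm. 5.22 with Lemma 14.109; Hartshorne II Ex. 3.20 (d),(e)): in an
affine chart `U ∋ x` with `A = Γ(X, U)` and `𝔭 = 𝔭_U(x)`, `dim 𝒪_{X,x} = ht 𝔭`,
`dim closure {x} = dim A/𝔭`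
(`Literature.AlgebraicGeometry.Dimension.Scheme.height_eq_ringKrullDim_quotient_primeIdealOf`),
`dim A/𝔭 + ht 𝔭 = dim A` (affine domains are catenary,
`Literature.RingTheory.KrullDimension.ringKrullDim_quotient_add_height`, Matsumura Thm. 5.6) and
`dim A = dim X`. [cite: GortzWedhorn2020, Thm. 5.22] -/
theorem coheight_add_height_eq_topologicalKrullDim {K : Type u} [Field K] {X : Scheme.{u}}
    [IsIntegral X] (f : X ⟶ Spec (.of K)) [LocallyOfFiniteType f] (x : X) :
    ((coheight x + height x : ℕ∞) : WithBot ℕ∞) = topologicalKrullDim X := by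
  obtain ⟨_, ⟨U, hU, rfl⟩, hxU, -⟩ :=
    X.isBasis_affineOpens.exists_subset_of_mem_open (Set.mem_univ x) isOpen_univ
  haveI : Nonempty U := ⟨⟨x, hxU⟩⟩
  let 𝔭 := hU.primeIdealOf ⟨x, hxU⟩
  -- `Γ(X, U)` is an affine domain over `K`
  let ι : K →+* Γ(Spec (CommRingCat.of K), ⊤) := (Scheme.ΓSpecIso (CommRingCat.of K)).inv.hom
  letI : Algebra K Γ(X, U) := ((f.appLE ⊤ U le_top).hom.comp ι).toAlgebra
  haveI : Algebra.FiniteType K Γ(X, U) := by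
    have h1 : (f.appLE ⊤ U le_top).hom.FiniteType :=
      f.finiteType_appLE (isAffineOpen_top _) hU le_top
    have h2 : ι.FiniteType :=
      RingHom.FiniteType.of_surjective _
        (Scheme.ΓSpecIso (CommRingCat.of K)).symm.commRingCatIsoToRingEquiv.surjective
    exact h1.comp h2
  -- `dim 𝒪_{X,x} = ht 𝔭`
  have h1 : (coheight x : WithBot ℕ∞) = 𝔭.asIdeal.height := by
    rw [← ringKrullDim_stalk_eq_coheight x]
    letI : Algebra Γ(X, U) (X.presheaf.stalk x) :=
      TopCat.Presheaf.algebra_section_stalk X.presheaf (⟨x, hxU⟩ : U)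
    haveI : IsLocalization.AtPrime (X.presheaf.stalk x) 𝔭.asIdeal :=
      hU.isLocalization_stalk ⟨x, hxU⟩
    exact IsLocalization.AtPrime.ringKrullDim_eq_height 𝔭.asIdeal (X.presheaf.stalk x)
  have h2 := Literature.AlgebraicGeometry.Dimension.Scheme.height_eq_ringKrullDim_quotient_primeIdealOf
    f hU hxU
  have h3 := Literature.RingTheory.KrullDimension.ringKrullDim_quotient_add_height K 𝔭.asIdeal
  have h4 := Literature.AlgebraicGeometry.Resolution.topologicalKrullDim_eq_ringKrullDim_of_isAffineOpen
    f hU ⟨x, hxU⟩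
  rw [h4, ← h3, ← h2, WithBot.coe_add, h1, add_comm]

/-! ### Residue fields of points of `k`-schemes as `k`-algebras -/

section ResidueFields

variable {k : Type u} [Field k] {Y : Scheme.{u}} (gY : Y ⟶ Spec (.of k))

/-- For a point `y` of a `k`-scheme `Y`, with `κ(y)` made a `k`-algebra through the ring map
underlying `Spec κ(y) → Y → Spec k` (Mathlib `Spec.preimage`), that composite is `Spec` of the
structure map. [folklore] -/
theorem fromSpecResidueField_comp_eq (y : Y) :
    letI : Algebra k (Y.residueField y) :=
      (Spec.preimage (Y.fromSpecResidueField y ≫ gY)).hom.toAlgebra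
    Y.fromSpecResidueField y ≫ gY =
      Spec.map (CommRingCat.ofHom (algebraMap k (Y.residueField y))) := by
  change _ = Spec.map (CommRingCat.ofHom (Spec.preimage (Y.fromSpecResidueField y ≫ gY)).hom)
  rw [CommRingCat.ofHom_hom, Spec.map_preimage]

end ResidueFields

/-! ### The inequality -/

/-- **`dim 𝒪_{Y,y} + dim 𝒪_{X_y,x̄} ≤ dim 𝒪_{X,x}` for a morphism of varieties with
equidimensional fibre** (the transcendence-degree count of Görtz–Wedhorn I Thm. 5.22 /
Hartshorne II Ex. 3.22; converse of Matsumura Thm. 15.1 (i)). Let `X`, `Y` be locally of finite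
type over a field `k` with `X` integral of dimension `n`, `dim Y ≤ m`, `f : X → Y` a
`k`-morphism, `x ∈ X`, `y = f x`, and suppose every irreducible component of the fibre `X_y` has
dimension `≤ r` where `n = m + r`. Then, for the point `x̄ = f.asFiber x` of `X_y` defined by `x`,
`dim 𝒪_{Y,y} + dim 𝒪_{X_y,x̄} ≤ dim 𝒪_{X,x}`: with `h = dim closure`, `c = dim 𝒪`,
`c(x) + h(x) = n`, `c(y) + h(y) ≤ m`, `c(x̄) + h(x̄) ≤ r` and
`h(x) = trdeg_k κ(x) = trdeg_k κ(y) + trdeg_{κ(y)} κ(x) = h(y) + h(x̄)`.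
[cite: GortzWedhorn2020, Thm. 5.22] -/
theorem ringKrullDim_stalk_add_ringKrullDim_stalk_fiber_le {k : Type u} [Field k]
    {X Y : Scheme.{u}} [IsIntegral X] (gX : X ⟶ Spec (.of k)) (gY : Y ⟶ Spec (.of k))
    [LocallyOfFiniteType gX] [LocallyOfFiniteType gY] (f : X ⟶ Y) (hf : f ≫ gY = gX)
    [LocallyOfFiniteType f] {n m r : ℕ} (hn : n = m + r) (hX : topologicalKrullDim X = n)
    (hY : topologicalKrullDim Y ≤ m) (x : X)
    (hfib : ∀ C ∈ irreducibleComponents (↥(f.fiber (f x)) : Type u), topologicalKrullDim C ≤ r) :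
    ringKrullDim (Y.presheaf.stalk (f x)) +
        ringKrullDim ((f.fiber (f x)).presheaf.stalk (f.asFiber x)) ≤
      ringKrullDim (X.presheaf.stalk x) := by
  -- `κ(x)`, `κ(f x)` as `k`-algebras, `κ(x)` as a `κ(f x)`-algebra: a scalar tower
  letI algX : Algebra k (X.residueField x) :=
    (Spec.preimage (X.fromSpecResidueField x ≫ gX)).hom.toAlgebra
  letI algY : Algebra k (Y.residueField (f x)) :=
    (Spec.preimage (Y.fromSpecResidueField (f x) ≫ gY)).hom.toAlgebra
  letI algXY : Algebra (Y.residueField (f x)) (X.residueField x) :=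
    (f.residueFieldMap x).hom.toAlgebra
  haveI : IsScalarTower k (Y.residueField (f x)) (X.residueField x) := by
    refine IsScalarTower.of_algebraMap_eq' ?_
    -- both sides are detected by `Spec`
    have key : CommRingCat.ofHom (algebraMap k (X.residueField x)) =
        CommRingCat.ofHom (algebraMap k (Y.residueField (f x))) ≫ f.residueFieldMap x := by
      apply Spec.map_injective
      rw [Spec.map_comp, ← fromSpecResidueField_comp_eq gX x, ← fromSpecResidueField_comp_eq gY,
        ← Category.assoc, Scheme.Hom.SpecMap_residueFieldMap_fromSpecResidueField,
        Category.assoc, hf]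
    exact congrArg CommRingCat.Hom.hom key
  -- heights are transcendence degrees
  have hBx : height x = Cardinal.toENat (Algebra.trdeg k (X.residueField x)) := by
    have := Literature.AlgebraicGeometry.Motives.Scheme.height_eq_toENat_trdeg_of_isPreimmersion
      gX (E := X.residueField x) (X.fromSpecResidueField x) (fromSpecResidueField_comp_eq gX x)
    rwa [Scheme.fromSpecResidueField_apply] at this
  have hAy : height (f x) = Cardinal.toENat (Algebra.trdeg k (Y.residueField (f x))) := by
    have := Literature.AlgebraicGeometry.Motives.Scheme.height_eq_toENat_trdeg_of_isPreimmersion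
      gY (E := Y.residueField (f x)) (Y.fromSpecResidueField (f x))
      (fromSpecResidueField_comp_eq gY (f x))
    rwa [Scheme.fromSpecResidueField_apply] at this
  have hFx : height (f.asFiber x) =
      Cardinal.toENat (Algebra.trdeg (Y.residueField (f x)) (X.residueField x)) := by
    haveI : LocallyOfFiniteType (f.fiberToSpecResidueField (f x)) :=
      MorphismProperty.pullback_snd (P := @LocallyOfFiniteType) _ _ inferInstance
    have := Literature.AlgebraicGeometry.Motives.Scheme.height_eq_toENat_trdeg_of_isPreimmersion
      (K := Y.residueField (f x)) (f.fiberToSpecResidueField (f x)) (E := X.residueField x)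
      (f.asFiberHom x) (f.asFiberHom_fiberToSpecResidueField x)
    rwa [Scheme.Hom.asFiberHom_apply] at this
  -- tower law
  haveI : FaithfulSMul k (Y.residueField (f x)) :=
    (faithfulSMul_iff_algebraMap_injective _ _).mpr (algebraMap k (Y.residueField (f x))).injective
  haveI : FaithfulSMul (Y.residueField (f x)) (X.residueField x) :=
    (faithfulSMul_iff_algebraMap_injective _ _).mpr (f.residueFieldMap x).hom.injective
  have htower : height x = height (f x) + height (f.asFiber x) := by
    rw [hBx, hAy, hFx, ← map_add,
      trdeg_add_eq k (Y.residueField (f x)) (A := X.residueField x)]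
  -- the three (in)equalities
  have hcx := coheight_add_height_eq_topologicalKrullDim gX x
  rw [hX] at hcx
  have hcy := height_add_coheight_le_topologicalKrullDim (f x)
  have hcF := height_add_coheight_le_topologicalKrullDim (f.asFiber x)
  have hF : topologicalKrullDim ↥(f.fiber (f x)) ≤ r :=
    topologicalKrullDim_le_of_forall_mem_irreducibleComponents _ r hfib
  -- rewrite the local dimensions as coheights and count
  rw [ringKrullDim_stalk_eq_coheight, ringKrullDim_stalk_eq_coheight,
    ringKrullDim_stalk_eq_coheight, ← WithBot.coe_add, WithBot.coe_le_coe]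
  have e1 : coheight x + height x = n := by exact_mod_cast hcx
  have e2 : height (f x) + coheight (f x) ≤ m := by exact_mod_cast hcy.trans hY
  have e3 : height (f.asFiber x) + coheight (f.asFiber x) ≤ r := by exact_mod_cast hcF.trans hF
  -- `c(y) + c(x̄) + h(x) ≤ m + r = n = c(x) + h(x)` and `h(x)` is finite
  have hfin : height x ≠ ⊤ := by
    intro htop
    rw [htop, add_top] at e1
    exact (ENat.coe_ne_top n) e1.symm
  have key : coheight (f x) + coheight (f.asFiber x) + height x ≤ coheight x + height x := by
    calc coheight (f x) + coheight (f.asFiber x) + height x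
        = (height (f x) + coheight (f x)) + (height (f.asFiber x) + coheight (f.asFiber x)) := by
          rw [htower]; ring
      _ ≤ m + r := add_le_add e2 e3
      _ = n := by exact_mod_cast hn.symm
      _ = coheight x + height x := e1.symm
  exact (ENat.add_le_add_iff_right hfin).mp key

end Literature.AlgebraicGeometry.Dimension

end
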